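import Mathlib
import HarnessLib
import Std.Data.TreeMap
import Literature.NumberTheory.LFunctions.ZetaKernelEvaluation

/-!
# A kernel-cheap certified evaluator of `ζ(s)` at height `t ≈ 3·10³` (hinted power table in a tree map)

Trunk T-ANT (NumberTheory/LFunctions) with T-VALNUM.  The certified Euler–Maclaurin evaluators `zetaBox` /
`zetaBoxK` store the table `n ↦ n^{-s}` in an `Array`; inside the kernel (`decide +kernel`) an `Array` is a
`List`, access is linear and a table of `N` entries costs `Θ(N²)` reductions (measured: `N = 800`, needed at
`t ≈ 3143`, does not fit in one declaration).  This file is a drop-in evaluator with the *same* mathematics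
(`riemannZeta_eq_eulerMaclaurin_of_re_pos`, `termsAux_spec`, `norm_emRem_mul_le_remRadius` reused) and
kernel-cheap data flow:
* the table lives in a `Std.TreeMap ℕ MC` (logarithmic access) and `Σ n^{-s}` is accumulated during the build;
* the build is driven by a HINT LIST `hints : List (ℕ × MI)`, entry `n ↦ (f, L)`: if `1 < f < n`, `f ∣ n`
  (checked in the kernel — a wrong hint is harmless) then `n^{-s} := f^{-s}·(n/f)^{-s}`, else
  `n^{-s} := e^{-σL}e^{-itL}` afresh (`cpowL`), sound when `log n ∈ L`; `HintsValid` records which `L` must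
  enclose `log n`, `logHintsOK` is a kernel-decidable sufficient check (two real exponentials per fresh entry at a
  finer scale), proved ONCE per hint list (`hintsValid_of_logHintsOK`) and passed to evaluations as a hypothesis;
* `mkTablesJ` (in the companion file) builds `Tables` whose (unused) logarithm table is the constant valid
  enclosure `[0, 8]`, so that `Tables.Valid` and the lemmas of `ZetaCertifiedEvaluation.lean` apply verbatim;
* **`zetaBoxH` / `mem_zetaBoxH`**: `T.Valid → HintsValid T.S 0 hints → hints.length = T.N + 1 → s ∈ sB →
  s ≠ 1 → zetaBoxH T sB hints = some Z → ζ(s) ∈ Z`; the companion `ZetaHintedBound.lean` bounds `‖ζ‖` on boxes.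

Measured (`v4.32.0`, `decide +kernel`): `N = 800`, `ν = 30`, scale `2^50`, `ζ(0.815 + 3143.22 i)` to radius
`≈ 5·10⁻⁹` in one declaration.  First consumer: the unconditional certificate for Haglund's Conjecture 1 at
`N = 27` (`Haglund2011/`), refutations bundle item (x).  AI-produced formalisation (H21 seat pub-refute-2, 2026-08-19).

## References
* H. M. Edwards, *Riemann's Zeta Function* (1974), §6.4. [Edwards1974]
* R. E. Moore, *Interval Analysis* (1966). [folklore]
-/

set_option autoImplicit false

open Finset Complex
open Literature.Analysis.ValidatedNumerics.NumericsMP Literature.NumberTheory.LFunctions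

namespace Literature.NumberTheory.LFunctions.ZetaNumerics

/-! ## `n^{-s}` from an explicit logarithm enclosure -/

/-- `n^{-s} = e^{-σ L} · e^{-i t L}` from an enclosure `L ∋ log n`. [folklore] -/
def cpowL (T : Tables) (sB : MC) (L : MI) : Option MC :=
  match MI.exp T.S T.Kexp T.kexp ((sB.re.mul T.S L).neg),
    MC.expI T.S T.KI T.kI T.piI ((sB.im.mul T.S L).neg) with
  | some mag, some ph => some (ph.mulMI T.S mag)
  | _, _ => none

/-- Soundness of `cpowL`. [folklore] -/
theorem mem_cpowL {T : Tables} (hT : T.Valid) {s : ℂ} {sB : MC} (hs : MC.mem T.S s sB) {n : ℕ}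
    (hn1 : 1 ≤ n) {L : MI} (hL : MI.mem T.S (Real.log n) L) {B : MC} (h : cpowL T sB L = some B) :
    MC.mem T.S ((n : ℂ) ^ (-s)) B := by
  unfold cpowL at h
  split at h
  · rename_i mag ph hmag hph
    simp only [Option.some.injEq] at h
    subst h
    have h1 : MI.mem T.S (-(s.re * Real.log n)) ((sB.re.mul T.S L).neg) :=
      MI.mem_neg (MI.mem_mul hT.S_pos hs.1 hL)
    have h2 : MI.mem T.S (-(s.im * Real.log n)) ((sB.im.mul T.S L).neg) :=
      MI.mem_neg (MI.mem_mul hT.S_pos hs.2 hL)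
    have hm := MI.mem_exp hT.S_pos hmag h1
    have hp := MC.mem_expI hT.S_pos hT.mem_pi hph h2
    rw [natCast_cpow_neg_eq hn1]
    exact MC.mem_mulMI hT.S_pos hp hm
  · simp at h

/-! ## Hints and their validity -/

/-- A hint `(f, L)` for the index `n` is USED MULTIPLICATIVELY iff `1 < f < n` and `f ∣ n`. [folklore] -/
def useFactor (n f : ℕ) : Bool := decide (1 < f) && decide (f < n) && decide (n % f = 0)

/-- What a usable factor hint guarantees. [folklore] -/
lemma useFactor_spec {n f : ℕ} (h : useFactor n f = true) : 1 < f ∧ f < n ∧ f ∣ n := by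
  simp only [useFactor, Bool.and_eq_true, decide_eq_true_eq] at h
  exact ⟨h.1.1, h.1.2, Nat.dvd_of_mod_eq_zero h.2⟩

/-- Validity of a hint list starting at index `n`: every entry that will be evaluated afresh
(`n ≥ 2`, factor hint unusable) encloses `log n`. [folklore] -/
def HintsValid (S : ℕ) : ℕ → List (ℕ × MI) → Prop
  | _, [] => True
  | n, h :: hs => (n ≤ 1 ∨ useFactor n h.1 = true ∨ MI.mem S (Real.log n) h.2) ∧ HintsValid S (n + 1) hs

/-- Kernel check of one hint: for an entry evaluated afresh, `exp(lo/S) ≤ n ≤ exp(hi/S)` certified by the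
interval exponential at the finer scale `S·2^guard`. [folklore] -/
def logHintOK (S guard Kexp kexp : ℕ) (n : ℕ) (h : ℕ × MI) : Bool :=
  if n ≤ 1 then true
  else if useFactor n h.1 then true
  else
    match MI.exp (S * 2 ^ guard) Kexp kexp ⟨h.2.lo * 2 ^ guard, h.2.lo * 2 ^ guard⟩,
      MI.exp (S * 2 ^ guard) Kexp kexp ⟨h.2.hi * 2 ^ guard, h.2.hi * 2 ^ guard⟩ with
    | some E1, some E2 =>
      decide (E1.hi ≤ (n : ℤ) * ((S * 2 ^ guard : ℕ) : ℤ)) && decide ((n : ℤ) * ((S * 2 ^ guard : ℕ) : ℤ) ≤ E2.lo)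
    | _, _ => false

/-- Kernel check of a hint list from index `n` on. [folklore] -/
def logHintsOK (S guard Kexp kexp : ℕ) : ℕ → List (ℕ × MI) → Bool
  | _, [] => true
  | n, h :: hs => logHintOK S guard Kexp kexp n h && logHintsOK S guard Kexp kexp (n + 1) hs

/-- The scaled point interval `⟨x·2^g, x·2^g⟩` at scale `S·2^g` encloses `x/S`. [folklore] -/
lemma mem_point_scaled {S : ℕ} (hS : 0 < S) (g : ℕ) (x : ℤ) :
    MI.mem (S * 2 ^ g) ((x : ℝ) / S) ⟨x * 2 ^ g, x * 2 ^ g⟩ := by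
  have hSr : (0 : ℝ) < S := by exact_mod_cast hS
  have : (x : ℝ) / S * ((S * 2 ^ g : ℕ) : ℝ) = ((x * 2 ^ g : ℤ) : ℝ) := by
    push_cast; field_simp
  refine ⟨?_, ?_⟩ <;> rw [this]

/-- Soundness of `logHintOK`. [folklore] -/
lemma logHintOK_sound {S guard Kexp kexp : ℕ} (hS : 0 < S) {n : ℕ} {h : ℕ × MI}
    (hok : logHintOK S guard Kexp kexp n h = true) :
    n ≤ 1 ∨ useFactor n h.1 = true ∨ MI.mem S (Real.log n) h.2 := by
  unfold logHintOK at hok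
  split_ifs at hok with h1 h2
  · exact Or.inl h1
  · exact Or.inr (Or.inl h2)
  · right; right
    split at hok
    · rename_i E1 E2 hE1 hE2
      simp only [Bool.and_eq_true, decide_eq_true_eq] at hok
      obtain ⟨hlo, hhi⟩ := hok
      have hS' : 0 < S * 2 ^ guard := Nat.mul_pos hS (pow_pos (by norm_num) _)
      have hS'r : (0 : ℝ) < ((S * 2 ^ guard : ℕ) : ℝ) := by exact_mod_cast hS'
      have hSr : (0 : ℝ) < S := by exact_mod_cast hS
      have hn : (1 : ℝ) < n := by exact_mod_cast (show 1 < n by omega)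
      have hn0 : (0 : ℝ) < n := by linarith
      have m1 := MI.mem_exp hS' hE1 (mem_point_scaled hS guard h.2.lo)
      have m2 := MI.mem_exp hS' hE2 (mem_point_scaled hS guard h.2.hi)
      -- `exp(lo/S) ≤ n` and `n ≤ exp(hi/S)`
      have e1 : Real.exp ((h.2.lo : ℝ) / S) ≤ n := by
        have := m1.2
        have hlo' : ((E1.hi : ℤ) : ℝ) ≤ (n : ℝ) * ((S * 2 ^ guard : ℕ) : ℝ) := by exact_mod_cast hlo
        exact le_of_mul_le_mul_right (this.trans hlo') hS'r
      have e2 : (n : ℝ) ≤ Real.exp ((h.2.hi : ℝ) / S) := by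
        have := m2.1
        have hhi' : (n : ℝ) * ((S * 2 ^ guard : ℕ) : ℝ) ≤ ((E2.lo : ℤ) : ℝ) := by exact_mod_cast hhi
        exact le_of_mul_le_mul_right (hhi'.trans this) hS'r
      refine ⟨?_, ?_⟩
      · have := (Real.le_log_iff_exp_le hn0).2 e1
        rwa [div_le_iff₀ hSr] at this
      · have := (Real.log_le_iff_le_exp hn0).2 e2
        rwa [le_div_iff₀ hSr] at this
    · simp at hok

/-- Soundness of `logHintsOK`. [folklore] -/
theorem hintsValid_of_logHintsOK {S guard Kexp kexp : ℕ} (hS : 0 < S) :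
    ∀ (hs : List (ℕ × MI)) (n : ℕ), logHintsOK S guard Kexp kexp n hs = true → HintsValid S n hs
  | [], _, _ => trivial
  | h :: hs, n, hok => by
    simp only [logHintsOK, Bool.and_eq_true] at hok
    exact ⟨logHintOK_sound hS hok.1, hintsValid_of_logHintsOK hS hs (n + 1) hok.2⟩

/-! ## The hinted power table in a tree map -/

/-- The state of the table walk: the map `n ↦ [n^{-s}]`, the running sum, the last entry. [folklore] -/
structure ZAcc where
  /-- `map[n] ∋ n^{-s}` for the indices processed so far -/
  map : Std.TreeMap ℕ MC compare
  /-- `Σ_{1 ≤ n < m} n^{-s}` -/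
  sum : MC
  /-- `(m-1)^{-s}` -/
  last : MC

/-- The box of `n^{-s}` from the hint `(f, L)` and the map of smaller entries. [folklore] -/
def zEntry (T : Tables) (sB : MC) (A : ZAcc) (n : ℕ) (h : ℕ × MI) : Option MC :=
  if n = 1 then some (MC.ofInt T.S 1)
  else if useFactor n h.1 then some (MC.mul T.S (A.map.getD h.1 default) (A.map.getD (n / h.1) default))
  else cpowL T sB h.2

/-- One step of the walk (index `0` is skipped). [folklore] -/
def zStep (T : Tables) (sB : MC) (A : ZAcc) (n : ℕ) (h : ℕ × MI) : Option ZAcc :=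
  if n = 0 then some A else
    match zEntry T sB A n h with
    | none => none
    | some b => some ⟨A.map.insert n b, A.sum.add b, b⟩

/-- The walk over the hint list from index `n`. [folklore] -/
def zBuild (T : Tables) (sB : MC) : ℕ → List (ℕ × MI) → ZAcc → Option ZAcc
  | _, [], A => some A
  | n, h :: hs, A =>
    match zStep T sB A n h with
    | none => none
    | some A' => zBuild T sB (n + 1) hs A'

/-- The invariant of the walk before index `m`: entries `1 ≤ j < m` are enclosed, the sum is
`Σ_{j ∈ [1, m)} j^{-s}`, and (for `m ≥ 2`) `last ∋ (m-1)^{-s}`. [folklore] -/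
structure ZInv (S : ℕ) (s : ℂ) (m : ℕ) (A : ZAcc) : Prop where
  mem_map : ∀ j : ℕ, 1 ≤ j → j < m → MC.mem S ((j : ℂ) ^ (-s)) (A.map.getD j default)
  mem_sum : MC.mem S (∑ j ∈ Finset.Ico 1 m, (j : ℂ) ^ (-s)) A.sum
  mem_last : 2 ≤ m → MC.mem S (((m - 1 : ℕ) : ℂ) ^ (-s)) A.last

/-- The invariant at the start of the walk. [folklore] -/
lemma zInv_start (T : Tables) (s : ℂ) : ZInv T.S s 1 ⟨∅, MC.ofInt T.S 0, MC.ofInt T.S 0⟩ :=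
  ⟨fun j h1 h2 ↦ by omega, by simpa using MC.mem_ofInt T.S 0, fun h ↦ by omega⟩

/-- Index `0` is skipped: the invariant before `0` gives the invariant before `1`. [folklore] -/
lemma zInv_zero_iff {S : ℕ} {s : ℂ} {A : ZAcc} : ZInv S s 0 A → ZInv S s 1 A := fun h ↦
  ⟨fun j h1 h2 ↦ by omega, by simpa using h.mem_sum, fun h ↦ by omega⟩

/-- Soundness of `zEntry`. [folklore] -/
lemma mem_zEntry {T : Tables} (hT : T.Valid) {s : ℂ} {sB : MC} (hs : MC.mem T.S s sB) {A : ZAcc} {m : ℕ}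
    (hI : ZInv T.S s m A) (hm : 1 ≤ m) {h : ℕ × MI}
    (hh : m ≤ 1 ∨ useFactor m h.1 = true ∨ MI.mem T.S (Real.log m) h.2) {b : MC}
    (hb : zEntry T sB A m h = some b) : MC.mem T.S ((m : ℂ) ^ (-s)) b := by
  unfold zEntry at hb
  split_ifs at hb with h1 h2
  · simp only [Option.some.injEq] at hb
    subst hb; rw [h1]; simpa using MC.mem_ofInt T.S 1
  · simp only [Option.some.injEq] at hb
    subst hb
    obtain ⟨hf1, hfm, hfd⟩ := useFactor_spec h2
    have hq1 : 1 ≤ m / h.1 := by rw [Nat.one_le_div_iff (by omega)]; exact hfm.le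
    have hqlt : m / h.1 < m := Nat.div_lt_self (by omega) hf1
    have hx := hI.mem_map h.1 (by omega) hfm
    have hy := hI.mem_map (m / h.1) hq1 hqlt
    have key : ((m : ℕ) : ℂ) ^ (-s) = (h.1 : ℂ) ^ (-s) * ((m / h.1 : ℕ) : ℂ) ^ (-s) := by
      rw [← natCast_mul_natCast_cpow, ← Nat.cast_mul, Nat.mul_div_cancel' hfd]
    rw [key]
    exact MC.mem_mul hT.S_pos hx hy
  · rcases hh with hh | hh | hh
    · omega
    · exact absurd hh h2
    · exact mem_cpowL hT hs hm hh hb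

/-- Soundness of `zStep`. [folklore] -/
lemma zInv_zStep {T : Tables} (hT : T.Valid) {s : ℂ} {sB : MC} (hs : MC.mem T.S s sB) {A A' : ZAcc} {m : ℕ}
    (hI : ZInv T.S s m A) {h : ℕ × MI} (hh : m ≤ 1 ∨ useFactor m h.1 = true ∨ MI.mem T.S (Real.log m) h.2)
    (hst : zStep T sB A m h = some A') : ZInv T.S s (m + 1) A' := by
  unfold zStep at hst
  split_ifs at hst with h0
  · simp only [Option.some.injEq] at hst
    subst hst; subst h0
    exact zInv_zero_iff hI
  · split at hst
    · simp at hst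
    · rename_i b hb
      simp only [Option.some.injEq] at hst
      subst hst
      have hm1 : 1 ≤ m := by omega
      have hbm := mem_zEntry hT hs hI hm1 hh hb
      refine ⟨fun j h1 h2 ↦ ?_, ?_, fun _ ↦ by simpa using hbm⟩
      · show MC.mem T.S ((j : ℂ) ^ (-s)) ((A.map.insert m b).getD j default)
        rw [Std.TreeMap.getD_insert]
        split_ifs with hc
        · rw [Nat.compare_eq_eq] at hc
          subst hc; exact hbm
        · rw [Nat.compare_eq_eq] at hc
          exact hI.mem_map j h1 (by omega)
      · show MC.mem T.S (∑ j ∈ Finset.Ico 1 (m + 1), (j : ℂ) ^ (-s)) (A.sum.add b)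
        rw [Finset.sum_Ico_succ_top hm1]
        exact MC.mem_add hI.mem_sum hbm

/-- Soundness of `zBuild`. [folklore] -/
theorem zInv_zBuild {T : Tables} (hT : T.Valid) {s : ℂ} {sB : MC} (hs : MC.mem T.S s sB) :
    ∀ (hs' : List (ℕ × MI)) (m : ℕ) {A A' : ZAcc}, ZInv T.S s m A → HintsValid T.S m hs' →
      zBuild T sB m hs' A = some A' → ZInv T.S s (m + hs'.length) A'
  | [], m, A, A', hI, _, h => by
    simp only [zBuild, Option.some.injEq] at h
    subst h; simpa using hI
  | hh :: hs', m, A, A', hI, hv, h => by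
    simp only [zBuild] at h
    split at h
    · simp at h
    · rename_i A1 hA1
      have hI1 := zInv_zStep hT hs hI hv.1 hA1
      have := zInv_zBuild hT hs hs' (m + 1) hI1 hv.2 h
      simp only [List.length_cons]
      rw [show m + (hs'.length + 1) = m + 1 + hs'.length by ring]
      exact this

/-! ## The hinted evaluator -/

/-- The correction terms from the box `PN ∋ N^{-s}` alone (cf. `termsBox`). [folklore] -/
def termsBoxPN (T : Tables) (sB PN : MC) : MC :=
  let t1 := ((MC.mul T.S sB PN).divNat 12).divNat T.N
  termsAux T sB T.ratios 1 t1 (MC.ofInt T.S 0)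

/-- `termsBox` depends on the table only through its `N`-th entry. [folklore] -/
lemma termsBox_eq_termsBoxPN (T : Tables) (sB : MC) (A : Array MC) :
    termsBox T sB A = termsBoxPN T sB (A.getD T.N default) := rfl

/-- Soundness of `termsBoxPN` (the proof of `mem_termsBox`, which reads only the `N`-th entry). [folklore] -/
theorem mem_termsBoxPN {T : Tables} (hT : T.Valid) {s : ℂ} {sB : MC} (hs : MC.mem T.S s sB) {PN : MC}
    (hPN : MC.mem T.S ((T.N : ℂ) ^ (-s)) PN) :
    MC.mem T.S (∑ j ∈ Finset.Icc 1 T.nu, emTerm T.N s j) (termsBoxPN T sB PN) := by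
  have hN1 : 1 ≤ T.N := le_trans (by norm_num) hT.two_le_N
  obtain ⟨hlen, hrat⟩ := ratios_spec hT
  have ht1 : MC.mem T.S (emTerm T.N s 1) (((MC.mul T.S sB PN).divNat 12).divNat T.N) := by
    have := MC.mem_divNat (MC.mem_divNat (MC.mem_mul hT.S_pos hs hPN) (n := 12) (by norm_num))
      (n := T.N) hN1
    convert this using 1
    unfold emTerm
    have hb2 : (bernoulli (2 * 1) : ℚ) = 1 / 6 := by
      rw [show 2 * 1 = 2 by rfl, bernoulli_eq_bernoulli'_of_ne_one (by norm_num), bernoulli'_two]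
    rw [hb2]
    have hN0 : (T.N : ℂ) ≠ 0 := by exact_mod_cast (show T.N ≠ 0 by omega)
    simp only [show 2 * 1 - 1 = 1 by rfl, emPoch_one, show (2 * 1).factorial = 2 by rfl]
    rw [show -(s + ((1 : ℕ) : ℂ)) = -s - 1 by push_cast; ring, cpow_sub _ _ hN0, cpow_one]
    push_cast
    field_simp
    ring
  have := termsAux_spec hT hs T.ratios 1 (by norm_num) (by rw [hlen]; have := hT.nu_ne; omega)
    (fun i hi ↦ by
      have := hrat i (by rw [hlen] at hi; omega)
      rw [show 1 + i + 1 = i + 2 by ring, show 1 + i = i + 1 by ring]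
      exact this)
    ht1 (MC.mem_ofInt T.S 0)
  simpa [termsBoxPN] using this

/-- **The hinted certified evaluator** of `ζ(s)` on a box `sB` (`0 < lo(re sB)` required): the main sum
`Σ_{n<N} n^{-s} + N^{1-s}/(s-1) + N^{-s}/2`, the `ν` correction terms and the remainder radius, with the power
table driven by `hints` (length `N + 1`, entry `0` unused). [folklore] -/
def zetaBoxH (T : Tables) (sB : MC) (hints : List (ℕ × MI)) : Option MC :=
  if 0 < sB.re.lo then
    match zBuild T sB 0 hints ⟨∅, MC.ofInt T.S 0, MC.ofInt T.S 0⟩ with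
    | none => none
    | some A =>
      match MC.divBox T.S (A.last.mulInt T.N) (sB.sub (MC.ofInt T.S 1)) with
      | none => none
      | some q =>
        some ((((A.sum.sub (A.last.divNat 2)).add q).add (termsBoxPN T sB A.last)).widen (remRadius T sB))
  else none

/-- **Soundness of the hinted evaluator**: `ζ(s) ∈ zetaBoxH T sB hints` for `s ∈ sB`, `s ≠ 1`, valid tables
and valid hints of the right length. [cite: Edwards1974, §6.4] -/
theorem mem_zetaBoxH {T : Tables} (hT : T.Valid) {hints : List (ℕ × MI)} (hv : HintsValid T.S 0 hints)
    (hlen : hints.length = T.N + 1) {s : ℂ} {sB : MC} (hs : MC.mem T.S s sB) (hs1 : s ≠ 1) {Z : MC}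
    (h : zetaBoxH T sB hints = some Z) : MC.mem T.S (riemannZeta s) Z := by
  unfold zetaBoxH at h
  split_ifs at h with hlo
  split at h
  · simp at h
  · rename_i A hA
    split at h
    · simp at h
    · rename_i q hq
      simp only [Option.some.injEq] at h
      subst h
      have hσ : 0 < s.re := MI.pos_of_lo_pos hs.1 hlo
      have hN1 : 1 ≤ T.N := le_trans (by norm_num) hT.two_le_N
      have hI0 : ZInv T.S s 0 ⟨∅, MC.ofInt T.S 0, MC.ofInt T.S 0⟩ :=
        ⟨fun j h1 h2 ↦ by omega, by simpa using MC.mem_ofInt T.S 0, fun h ↦ by omega⟩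
      have hI := zInv_zBuild hT hs hints 0 hI0 hv hA
      rw [hlen, zero_add] at hI
      have hPN : MC.mem T.S ((T.N : ℂ) ^ (-s)) A.last := by
        have := hI.mem_last (by omega)
        simpa using this
      -- the pieces of the main term
      have hsum : MC.mem T.S (∑ j ∈ Finset.Ico 1 T.N, (j : ℂ) ^ (-s) + (T.N : ℂ) ^ (-s) / 2)
          (A.sum.sub (A.last.divNat 2)) := by
        have h1 := hI.mem_sum
        rw [Finset.sum_Ico_succ_top hN1] at h1
        have h2 : MC.mem T.S ((T.N : ℂ) ^ (-s) / 2) (A.last.divNat 2) := by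
          have := MC.mem_divNat hPN (n := 2) (by norm_num)
          simpa using this
        have := MC.mem_sub h1 h2
        convert this using 1
        ring
      have hq' : MC.mem T.S ((T.N : ℂ) ^ (1 - s) / (s - 1)) q := by
        have h1 := MC.mem_divBox hT.S_pos hq (MC.mem_mulInt hPN (T.N : ℤ))
          (MC.mem_sub hs (MC.mem_ofInt T.S 1))
        convert h1 using 1
        have hN0 : (T.N : ℂ) ≠ 0 := by exact_mod_cast (show T.N ≠ 0 by omega)
        rw [sub_eq_add_neg, cpow_add _ _ hN0, cpow_one]
        push_cast
        ring
      have hmain : MC.mem T.S (emMainZero T.N s) ((A.sum.sub (A.last.divNat 2)).add q) := by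
        unfold emMainZero
        convert MC.mem_add hsum hq' using 1
        ring
      have hterms := mem_termsBoxPN hT hs hPN
      have htot := MC.mem_add hmain hterms
      rw [riemannZeta_eq_eulerMaclaurin_of_re_pos hN1 hσ hs1 T.nu]
      apply MC.mem_widen htot
      rw [show emMainZero T.N s + ∑ k ∈ Finset.Icc 1 T.nu, emTerm T.N s k + emRemHigher T.N T.nu s -
        (emMainZero T.N s + ∑ j ∈ Finset.Icc 1 T.nu, emTerm T.N s j) = emRemHigher T.N T.nu s by ring]
      exact norm_emRem_mul_le_remRadius hT hs hσ

end Literature.NumberTheory.LFunctions.ZetaNumerics
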